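/-
Copyright (c) 2026. All rights reserved.
Released under Apache 2.0 license as described in the file LICENSE.
Authors: abc-iut cell, prover seat abc-iut-c312-5 (Cor. 3.12 sub-crew, gen 7).
-/
import Literature.IUT.LogVolume.TensorPacketConductor
import Literature.IUT.LogVolume.AdaptedBasis
import Literature.IUT.LogVolume.LogShellTopology
import HarnessLib

/-!
# The EXACT content of a box `u·(R_I)^∼` in the tensor log-shell `⊗ log_p(R_i^×)`: the INNER RADII of the factor
# shells and the differents decide it ([IUTchIV] Prop. 1.1/1.2 made exact; Dupuy–Hilado §4.9–4.12)

abc-iut cell, seat abc-iut-c312-5 (D-0079 sub-cell R-W «WINDOW Θ-SIDE INEQUALITY», lane U, task T2 «structure of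
`log_p(𝒪^×)` at non-tame places and the hull of the (Ind1)(Ind2)-orbit», part 2 of 2 over `TensorPacketConductor.lean`).
PROOF-ONLY file (no definitions, no named `Prop` facts); classical lattice algebra over the cell's REAL definitions.

* §4 ONE FIELD: `exists_traceDual_logUnits_of_not_mem` — for `w ∉ log_p(R^×)` there is a trace-dual test element `y`
  (`Tr(y·log_p(R^×)) ⊆ ℤ_p`) with `‖δ‖·‖y‖·‖w‖ > 1` (write `log_p(R^×) = ⊕ c'_j ℤ_p b_j` in an adapted integral basis —
  abc-iut-S8's `exists_adaptedBasis` — and take `y = c'_j⁻¹·d_j` for the trace dual `d` of `b` at a coordinate where `w`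
  is too large); `norm_traceDual_logUnits_le` — every test element has `‖δ‖·‖y‖·‖c‖ ≤ 1` for an inner ball
  `c·R ⊆ log_p(R^×)`; hence at the LARGEST inner ball (`‖c‖ = ρ_in`, some `w ∉ log_p(R^×)` with `‖w‖·‖ϖ‖ ≤ ‖c‖`) a test
  element with `‖δ‖·‖y‖·‖c‖ ≥ 1` exists (`exists_traceDual_logUnits_norm_ge`, discreteness of `|K^×|`): the largest
  test element has norm EXACTLY `(‖δ‖·ρ_in)⁻¹`.
* §5 **`smul_normalizedPacket_subset_logPacket_iff`** — THE EXACT CRITERION: with the largest inner balls `c_i·R_i` of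
  the factor shells, `u·(R_I)^∼ ⊆ log_p(R_I^×) ⟺ ∀ J, ‖ψ_J(u)‖ ≤ p^{−(d_I − d_{L_J})}·∏_i ρ_in(log_p(R_i^×))`; and its
  CONTENT form for slot boxes **`iota_smul_normalizedPacket_subset_zpow_smul_logPacket_iff`**:
  `ι_b(t)·(R_I)^∼ ⊆ p^m·log_p(R_I^×) ⟺ ∀ J, p^m·‖t‖ ≤ p^{−(d_I − d_{L_J})}·∏_i ρ_in` — the content of every Θ-slot box
  is `⌊v_p(t) − (d_I − min_J d_{L_J}) − Σ_i α_i⌋` (`ρ_in(log_p(R_i^×)) = p^{−α_i}`), INDEPENDENT of the slot `b`.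
  abc-iut-w6-d018's undecided band `{a_I + b_I + 1}·log p` for the content (`TensorPacketContentSharp(Upper)`) is
  thereby ZERO.  With abc-iut-w5-d180's `hull(⋃_{γ∈Ind2} γ·M) = hull(p^m·log_p(R_I^×))` (`TensorPacketOrbitContent`;
  factorwise form `TensorPacketFactorwiseOrbitSpan`) and `hull(log_p(R_I^×))` read off the OUTER radii, this decides
  the per-summand (xi-f) inclusion «q-box ⊆ holomorphic hull of the (Ind1)(Ind2)-orbit of the Θ-box» from TWO
  one-factor invariants of each shell (inner radius `ρ_in = ‖ϖ‖^{r_in}`, outer radius `ρ_out = ‖ϖ‖^{r_out}`) and the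
  differents: `v_p(t_q) + Σ_i r_out(i)/e_i ≥ ⌊v_p(t_Θ) − (d_I − min_J d_{L_J}) − Σ_i r_in(i)/e_i⌋`.  At TAME factors
  (`log_p(R_i^×) = 𝔪_i`, `r_in = r_out = 1`) this is abc-iut-w5-d180's exact tame dichotomy
  «`m_q ≥ e·⌊(m_Θ − 1)/e⌋ + 1 − j(e − 1)`» (`Cor312LicenceExplicitDepthExact`); at WILD factors it is new.

Classical (Weil, *Basic Number Theory* II §2 Th. 1; Serre, *Corps locaux* III §3); the tags record the cell's typing
of [IUTchIV] §1. [cite: Mochizuki2012, IUTchIV Prop. 1.1 p. 9, Prop. 1.2 (i)(ii) p. 10] [cite: DupuyHilado2025, §4.9, §4.12]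
[cite: WeilBNT1967, Ch. II §2, Th. 1] No side taken on [IUTchIII] Cor. 3.12 [claim: Mochizuki2012, status: disputed].
-/

noncomputable section

open Set Module Function
open scoped Pointwise TensorProduct NormedField nonZeroDivisors

namespace Literature.IUT.LogVolume

/-! ## 4. One field: the largest trace-dual test element of `log_p(R^×)` has norm `(‖δ‖·ρ_in)⁻¹` -/

section OneField

variable {p : ℕ} [Fact p.Prime]
variable {K : Type} [NontriviallyNormedField K] [NormedAlgebra ℚ_[p] K] [IsUltrametricDist K]
  [ProperSpace K]

/-- **Upper bound.** For a trace-dual test element `y` of `log_p(R^×)` (`Tr(y·log_p(R^×)) ⊆ ℤ_p`) and an inner ball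
`c·R ⊆ log_p(R^×)`: `‖δ‖·‖y‖·‖c‖ ≤ 1` (`Tr(y·c·R) ⊆ ℤ_p` puts `y·c` in `𝔇⁻¹ = δ⁻¹R`).
[cite: Mochizuki2012, IUTchIV Prop. 1.1 p. 9] -/
theorem norm_traceDual_logUnits_le {δ : Valued.integer K} (hδ : different p K = Ideal.span {δ}) {y c : K}
    (hy : ∀ z ∈ logUnits K, ‖Algebra.trace ℚ_[p] K (y * z)‖ ≤ 1)
    (hc : ∀ o : K, ‖o‖ ≤ 1 → c * o ∈ logUnits K) : ‖(δ : K)‖ * ‖y‖ * ‖c‖ ≤ 1 := by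
  have h := norm_mul_le_one_of_forall_norm_trace_mul_le_one (p := p) hδ (z := y * c) fun w hw => by
    rw [mul_assoc]; exact hy _ (hc w hw)
  rwa [norm_mul, norm_mul, ← mul_assoc] at h

/-- **Existence.** If `w ∉ log_p(R^×)` there is a trace-dual test element `y` of `log_p(R^×)` with
`‖δ‖·‖y‖·‖w‖ > 1`: write `log_p(R^×) = ⊕ c'_j ℤ_p b_j` in an adapted integral basis (abc-iut-S8's
`exists_adaptedBasis`), let `d` be the trace dual of `b`; some coordinate `b.repr w j` has norm `> ‖c'_j‖`, and
`y = c'_j⁻¹·d_j` pairs `log_p(R^×)` into `ℤ_p` but `Tr(y·w) = c'_j⁻¹·b.repr w j ∉ ℤ_p`, so `y·w ∉ 𝔇⁻¹`.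
[cite: WeilBNT1967, Ch. II §2, Th. 1] -/
theorem exists_traceDual_logUnits_of_not_mem {δ : Valued.integer K} (hδ : different p K = Ideal.span {δ})
    {w : K} (hw : w ∉ logUnits K) :
    ∃ y : K, (∀ z ∈ logUnits K, ‖Algebra.trace ℚ_[p] K (y * z)‖ ≤ 1) ∧ 1 < ‖(δ : K)‖ * ‖y‖ * ‖w‖ := by
  classical
  obtain ⟨n, bZ, b, c, hn, hb, hmem⟩ := exists_adaptedBasis p (logUnitsAddSubgroup p K)
    (isOpen_logUnits p K) (isCompact_logUnits p K)
  obtain ⟨d, hd⟩ := exists_traceDual_basis (p := p) b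
  have hcpos : ∀ j, 0 < ‖(c j : ℚ_[p])‖ := fun j => norm_pos_iff.mpr (Units.ne_zero _)
  -- `w ∉ log_p(R^×)`: some coordinate is too large
  have hw' : ¬ ∀ j, ‖b.repr w j‖ ≤ ‖(c j : ℚ_[p])‖ := fun h =>
    hw ((hmem w).mpr ((PadicModule.mem_boxLattice p b c).mpr h))
  push Not at hw'
  obtain ⟨j, hj⟩ := hw'
  -- the test element `y = c_j⁻¹ · d_j`
  have htrace : ∀ v : K, Algebra.trace ℚ_[p] K ((((c j : ℚ_[p]))⁻¹ • d j) * v) = ((c j : ℚ_[p]))⁻¹ * b.repr v j := by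
    intro v
    rw [smul_mul_assoc, map_smul, smul_eq_mul, mul_comm (d j) v, ← dualPair_repr_left b d hd v j]
  refine ⟨((c j : ℚ_[p]))⁻¹ • d j, fun z hz => ?_, ?_⟩
  · have hzj : ‖b.repr z j‖ ≤ ‖(c j : ℚ_[p])‖ := (PadicModule.mem_boxLattice p b c).mp ((hmem z).mp hz) j
    rw [htrace, norm_mul, norm_inv, inv_mul_le_iff₀ (hcpos j), mul_one]
    exact hzj
  · by_contra hle
    push Not at hle
    have h1 : ‖(δ : K) * ((((c j : ℚ_[p]))⁻¹ • d j) * w)‖ ≤ 1 := by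
      rw [norm_mul, norm_mul, ← mul_assoc]; exact hle
    have h2 := norm_trace_le_one_of_norm_mul_le_one (p := p) hδ h1
    rw [htrace, norm_mul, norm_inv, inv_mul_le_iff₀ (hcpos j), mul_one] at h2
    exact absurd h2 (not_le.mpr hj)

/-- **The inner radius decides the largest test element.** If the ball `c·R ⊆ log_p(R^×)` is MAXIMAL — some
`w ∉ log_p(R^×)` has `‖w‖·‖ϖ‖ ≤ ‖c‖` — then a trace-dual test element `y` of `log_p(R^×)` has `‖δ‖·‖y‖·‖c‖ ≥ 1`
(existence above, then discreteness of `|K^×|`); with `norm_traceDual_logUnits_le` the largest test element has norm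
EXACTLY `(‖δ‖·‖c‖)⁻¹`. [cite: WeilBNT1967, Ch. II §2, Th. 1] -/
theorem exists_traceDual_logUnits_norm_ge {δ : Valued.integer K} (hδ : different p K = Ideal.span {δ})
    {ϖ : Kˣ} (hϖ : Literature.NumberTheory.GaloisRepresentations.Ultrametric.IsUniformizer ϖ) {c w : K} (hc0 : c ≠ 0)
    (hw : w ∉ logUnits K) (hwc : ‖w‖ * ‖(ϖ : K)‖ ≤ ‖c‖) :
    ∃ y : K, (∀ z ∈ logUnits K, ‖Algebra.trace ℚ_[p] K (y * z)‖ ≤ 1) ∧ 1 ≤ ‖(δ : K)‖ * ‖y‖ * ‖c‖ := by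
  obtain ⟨y, hy, hlt⟩ := exists_traceDual_logUnits_of_not_mem (p := p) hδ hw
  refine ⟨y, hy, ?_⟩
  have hρ0 : 0 < ‖(ϖ : K)‖ := Literature.NumberTheory.GaloisRepresentations.Ultrametric.norm_units_pos ϖ
  have hδ0 : (δ : K) ≠ 0 := by exact_mod_cast generator_ne_zero p K hδ
  have hy0 : y ≠ 0 := by
    rintro rfl
    rw [norm_zero, mul_zero, zero_mul] at hlt
    exact absurd hlt (not_lt.mpr zero_le_one)
  -- `‖δ y c‖ > ‖ϖ‖`
  have hgt : ‖(ϖ : K)‖ < ‖(δ : K)‖ * ‖y‖ * ‖c‖ := by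
    have h1 : ‖(δ : K)‖ * ‖y‖ * ‖w‖ * ‖(ϖ : K)‖ ≤ ‖(δ : K)‖ * ‖y‖ * ‖c‖ := by
      rw [mul_assoc (‖(δ : K)‖ * ‖y‖)]
      exact mul_le_mul_of_nonneg_left hwc (by positivity)
    calc ‖(ϖ : K)‖ = 1 * ‖(ϖ : K)‖ := (one_mul _).symm
      _ < ‖(δ : K)‖ * ‖y‖ * ‖w‖ * ‖(ϖ : K)‖ := mul_lt_mul_of_pos_right hlt hρ0
      _ ≤ _ := h1
  -- discreteness: the norm of the nonzero element `δ y c` is `‖ϖ‖^t` with `t ≤ 0`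
  have hne : (δ : K) * y * c ≠ 0 := mul_ne_zero (mul_ne_zero hδ0 hy0) hc0
  obtain ⟨t, ht⟩ := hϖ.2 (Units.mk0 _ hne)
  rw [Units.val_mk0, norm_mul, norm_mul] at ht
  rw [ht] at hgt ⊢
  have ht1 : t < 1 := by
    have hgt' : ‖(ϖ : K)‖ ^ (1 : ℤ) < ‖(ϖ : K)‖ ^ t := by rw [zpow_one]; exact hgt
    exact (zpow_lt_zpow_iff_right_of_lt_one₀ hρ0 hϖ.1).mp hgt'
  calc (1 : ℝ) = ‖(ϖ : K)‖ ^ (0 : ℤ) := (zpow_zero _).symm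
    _ ≤ ‖(ϖ : K)‖ ^ t := zpow_le_zpow_right_of_le_one₀ hρ0 hϖ.1.le (by omega)

end OneField

/-! ## 5. The exact criterion and the content of a slot box -/

section Exact

open Literature.NumberTheory.GaloisRepresentations.Ultrametric

variable (p : ℕ) [Fact p.Prime]
variable {I : Type} [Fintype I] [DecidableEq I] [Nonempty I]
variable (k : I → Type) [∀ i, NontriviallyNormedField (k i)] [∀ i, NormedAlgebra ℚ_[p] (k i)]
  [∀ i, IsUltrametricDist (k i)] [∀ i, ProperSpace (k i)]

omit [DecidableEq I] [Nonempty I] in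
/-- `∏_i ‖δ_i‖ = p^{−d_I}` for generators `δ_i` of the differents. [cite: Mochizuki2012, IUTchIV Prop. 1.1 p. 9] -/
theorem prod_norm_generators_eq (δ : Π i, Valued.integer (k i)) (hδ : ∀ i, different p (k i) = Ideal.span {δ i}) :
    ∏ i, ‖(δ i : k i)‖ = (p : ℝ) ^ (-dSum p k) := by
  have hp0 : (0 : ℝ) < p := by exact_mod_cast (Fact.out : p.Prime).pos
  rw [dSum, ← Finset.sum_neg_distrib, Real.rpow_sum_of_pos hp0]
  exact Finset.prod_congr rfl fun i _ =>
    norm_eq_rpow_neg_differentOrd p (k i) (hδ i) (generator_ne_zero p (k i) (hδ i))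

/-- **THE EXACT CRITERION.**  Let `c_i·R_i` be the LARGEST ball inside the factor shell `log_p(R_i^×)` (`c_i ≠ 0`,
`c_i·R_i ⊆ log_p(R_i^×)`, and some `w_i ∉ log_p(R_i^×)` with `‖w_i‖·‖ϖ_i‖ ≤ ‖c_i‖`; `‖c_i‖ = ρ_in(log_p(R_i^×))`, the
INNER RADIUS).  Then for every `u ∈ V`:
`u·(R_I)^∼ ⊆ log_p(R_I^×) ⟺ ∀ J, ‖ψ_J(u)‖ ≤ p^{−(d_I − d_{L_J})} · ∏_i ρ_in(log_p(R_i^×))`.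
[IUTchIV] Prop. 1.2 (ii) is the sufficiency with `ρ_in ≥ p^{−a_i}`; at `R_i` in place of the shells (`ρ_in = 1`) this is
the conductor of §2. [cite: Mochizuki2012, IUTchIV Prop. 1.1 p. 9, Prop. 1.2 (i)(ii) p. 10] [cite: DupuyHilado2025, §4.12] -/
theorem smul_normalizedPacket_subset_logPacket_iff {c : Π i, k i} (hc0 : ∀ i, c i ≠ 0)
    (hc : ∀ i (o : k i), ‖o‖ ≤ 1 → c i * o ∈ logUnits (k i))
    (hmax : ∀ i, ∃ (ϖ : (k i)ˣ) (w : k i), IsUniformizer ϖ ∧ w ∉ logUnits (k i) ∧ ‖w‖ * ‖(ϖ : k i)‖ ≤ ‖c i‖)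
    (u : PacketAlgebra p k) :
    u • (normalizedPacket p k : Set (PacketAlgebra p k)) ⊆ (logPacket p k : Set (PacketAlgebra p k)) ↔
      ∀ J, ‖dEquiv p k u J‖ ≤ (p : ℝ) ^ (-(dSum p k - differentOrd p (DFac p k J))) * ∏ i, ‖c i‖ := by
  refine ⟨fun hu J => ?_, smul_normalizedPacket_subset_logPacket_of_norm_dEquiv_le p k hc0 hc⟩
  have hp0 : (0 : ℝ) < p := by exact_mod_cast (Fact.out : p.Prime).pos
  -- generators of the differents and maximal test elements at every factor
  have hgen := fun i => exists_different_eq_span p (k i)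
  choose δ hδ using hgen
  have hwit : ∀ i, ∃ y : k i, (∀ z ∈ logUnits (k i), ‖Algebra.trace ℚ_[p] (k i) (y * z)‖ ≤ 1) ∧
      1 ≤ ‖(δ i : k i)‖ * ‖y‖ * ‖c i‖ := fun i => by
    obtain ⟨ϖ, w, hϖ, hw, hwc⟩ := hmax i
    exact exists_traceDual_logUnits_norm_ge (p := p) (hδ i) hϖ (hc0 i) hw hwc
  choose y hy hy1 using hwit
  have hB := norm_dEquiv_mul_prod_le_of_smul_normalizedPacket_subset_logPacket p k hu hy J
  -- `∏ (‖δ_i‖‖c_i‖)⁻¹ ≤ ∏ ‖y_i‖`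
  have hdc : ∀ i, 0 < ‖(δ i : k i)‖ * ‖c i‖ := fun i =>
    mul_pos (norm_pos_iff.mpr (by exact_mod_cast generator_ne_zero p (k i) (hδ i))) (norm_pos_iff.mpr (hc0 i))
  have hyge : ∀ i, (‖(δ i : k i)‖ * ‖c i‖)⁻¹ ≤ ‖y i‖ := fun i => by
    rw [inv_le_iff_one_le_mul₀ (hdc i)]
    calc (1 : ℝ) ≤ ‖(δ i : k i)‖ * ‖y i‖ * ‖c i‖ := hy1 i
      _ = ‖y i‖ * (‖(δ i : k i)‖ * ‖c i‖) := by ring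
  have hprod : ∏ i, (‖(δ i : k i)‖ * ‖c i‖)⁻¹ ≤ ∏ i, ‖y i‖ :=
    Finset.prod_le_prod (fun i _ => (inv_pos.mpr (hdc i)).le) fun i _ => hyge i
  have hprodpos : 0 < ∏ i, (‖(δ i : k i)‖ * ‖c i‖)⁻¹ := Finset.prod_pos fun i _ => inv_pos.mpr (hdc i)
  -- `‖ψ_J(u)‖ · ∏ (‖δ_i‖‖c_i‖)⁻¹ ≤ p^{d_J}`
  have h1 : ‖dEquiv p k u J‖ * ∏ i, (‖(δ i : k i)‖ * ‖c i‖)⁻¹ ≤ (p : ℝ) ^ differentOrd p (DFac p k J) :=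
    (mul_le_mul_of_nonneg_left hprod (norm_nonneg _)).trans hB
  rw [← le_div_iff₀ hprodpos] at h1
  refine h1.trans (le_of_eq ?_)
  rw [Finset.prod_inv_distrib, div_inv_eq_mul, Finset.prod_mul_distrib, prod_norm_generators_eq p k δ hδ,
    ← mul_assoc, ← Real.rpow_add hp0,
    show differentOrd p (DFac p k J) + -dSum p k = -(dSum p k - differentOrd p (DFac p k J)) by ring]

/-- **THE CONTENT OF A SLOT BOX.**  With the largest inner balls `c_i·R_i` of the factor shells as above, for every slot
`b`, every `t ∈ k_b` and every `m ∈ ℤ`: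
`ι_b(t)·(R_I)^∼ ⊆ p^m·log_p(R_I^×) ⟺ ∀ J, p^m·‖t‖ ≤ p^{−(d_I − d_{L_J})}·∏_i ‖c_i‖` — so the content of the box with
respect to the tensor log-shell is `⌊v_p(t) − (d_I − min_J d_{L_J}) − Σ_i α_i⌋` (`‖c_i‖ = p^{−α_i}`), independent of
`b`; with abc-iut-w5-d180's `hull(⋃_{γ ∈ Ind2} γ·M) = hull(p^m·log_p(R_I^×))` this is the exact input of the per-summand
hull computation. [cite: Mochizuki2012, IUTchIV Prop. 1.2 (ii) p. 10] [cite: DupuyHilado2025, §4.9, §4.12] -/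
theorem iota_smul_normalizedPacket_subset_zpow_smul_logPacket_iff {c : Π i, k i} (hc0 : ∀ i, c i ≠ 0)
    (hc : ∀ i (o : k i), ‖o‖ ≤ 1 → c i * o ∈ logUnits (k i))
    (hmax : ∀ i, ∃ (ϖ : (k i)ˣ) (w : k i), IsUniformizer ϖ ∧ w ∉ logUnits (k i) ∧ ‖w‖ * ‖(ϖ : k i)‖ ≤ ‖c i‖)
    (b : I) (t : k b) (m : ℤ) :
    iota p k b t • (normalizedPacket p k : Set (PacketAlgebra p k)) ⊆
        ((p : ℚ_[p]) ^ m) • (logPacket p k : Set (PacketAlgebra p k)) ↔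
      ∀ J, (p : ℝ) ^ m * ‖t‖ ≤ (p : ℝ) ^ (-(dSum p k - differentOrd p (DFac p k J))) * ∏ i, ‖c i‖ := by
  have hp : p.Prime := Fact.out
  have hpm0 : ((p : ℚ_[p]) ^ m) ≠ 0 := zpow_ne_zero _ (Nat.cast_ne_zero.mpr hp.ne_zero)
  rw [Set.subset_smul_set_iff₀ hpm0, smul_set_eq_algebraMap_smul, smul_smul, ← smul_eq_mul,
    smul_normalizedPacket_subset_logPacket_iff p k hc0 hc hmax]
  refine forall_congr' fun J => ?_
  rw [smul_eq_mul, map_mul, Pi.mul_apply, norm_mul, AlgEquiv.commutes, Pi.algebraMap_apply, norm_algebraMap',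
    norm_inv, Padic.norm_p_zpow, zpow_neg, inv_inv, norm_dEquiv_iota]

end Exact

end Literature.IUT.LogVolume

end
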